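import Summits.ValiantsHypothesis.ValiantsHypothesis.Theorems.SymPencilSdcPerFourTwentySeven
import Summits.ValiantsHypothesis.ValiantsHypothesis.Theorems.SymPencilPerFourSixDimNoJointFamily
import Summits.ValiantsHypothesis.ValiantsHypothesis.Theorems.SymPencilSdcPerFourTwentyNine

/-!
# Route `SymPencil` — `27 ≤ sdc(per_4) ≤ 29`, UNCONDITIONAL (`--supports`
# stmt-ValiantsHypothesis-5674 `SdcSuperquadratic`; rung currency only — nothing here bears on
# `VP ≠ VNP`)

Assembly of two independent lanes of the cell val-width:

 * `SymPencilPerFourSixDimNoJointFamily.noJointFamily_six` (val-width-5674-p3 g2): the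
   six-dimensional cell hypothesis `H106` holds — no `6`-dimensional `V ⊆ Sing Z(per_4)` carries
   a joint family with fewer than six squares (dispatch at dimension `6`: proportional pair, zero
   cell, toric case);
 * `SymPencilSdcPerFourTwentySeven.twentySeven_le_of_H106₅` (val-width-5676-p2 g5): given
   `H106₅`, every symmetric affine determinantal representation of `per_4` has size `≥ 27` (the
   one-row kernel cells `(12,4,0)`, `(12,4,1)` are empty by the base-point expansion of the
   pencil).

**Theorem** (`twentySeven_le_of_isSymm_isAffineDetRepr_perPoly_four`): over a field of
characteristic `0`, every symmetric affine determinantal representation of `per_4` has size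
`≥ 27`; with the explicit `29 × 29` pencil of `SymPencilSdcPerFourTwentyNine` the window is
**`27 ≤ sdc(per₄) ≤ 29`** (`sdc_perPoly_four_window_twentySeven`).  The open sizes are `27`, `28`.

Honest framing: an `n = 4` calibration value for the aside item `SdcSuperquadratic` (which asks
for a superquadratic lower bound in `n` and stays open); `VP ≠ VNP` is not moved.  No definitions,
no named facts. [folklore]
-/

noncomputable section

-- single-conjunct layout: Sub = Summit, duplicated namespace component intended
set_option linter.dupNamespace false

namespace Summit.ValiantsHypothesis.ValiantsHypothesis.Theorems.SymPencilSdcPerFourWindowTwentySeven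

open Matrix MvPolynomial Module
open Literature.Computability.AlgebraicComplexity
open Summit.ValiantsHypothesis.ValiantsHypothesis.Theorems.SymPencilSdcPerFourTwentySeven
open Summit.ValiantsHypothesis.ValiantsHypothesis.Theorems.SymPencilPerFourSixDimNoJointFamily

variable (K : Type*) [Field K] [CharZero K]

/-- **Every symmetric affine determinantal representation of `per_4` has size `≥ 27`**
(characteristic `0`, unconditional). [folklore] -/
theorem twentySeven_le_of_isSymm_isAffineDetRepr_perPoly_four
    {m : ℕ} {A : Matrix (Fin m) (Fin m) (MvPolynomial (Fin 4 × Fin 4) K)}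
    (hS : A.IsSymm) (hA : IsAffineDetRepr (perPoly (Fin 4) K) A) : 27 ≤ m :=
  twentySeven_le_of_H106₅ K (fun V hV h6 c β => noJointFamily_six (by norm_num) V hV h6 c β)
    hS hA

/-- **No symmetric affine determinantal representation of `per_4` has size `≤ 26`**
(characteristic `0`). [folklore] -/
theorem false_of_isSymm_isAffineDetRepr_perPoly_four_le_twentySix {m : ℕ} (hm : m ≤ 26)
    {A : Matrix (Fin m) (Fin m) (MvPolynomial (Fin 4 × Fin 4) K)}
    (hS : A.IsSymm) (hA : IsAffineDetRepr (perPoly (Fin 4) K) A) : False := by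
  have h := twentySeven_le_of_isSymm_isAffineDetRepr_perPoly_four K hS hA
  omega

/-- **The window `27 ≤ sdc(per₄) ≤ 29`** over any field of characteristic `0`. [folklore] -/
theorem sdc_perPoly_four_window_twentySeven :
    27 ≤ symmDeterminantalComplexity (perPoly (Fin 4) K) ∧
      symmDeterminantalComplexity (perPoly (Fin 4) K) ≤ 29 := by
  refine ⟨?_, SymPencilSdcPerFourTwentyNine.sdc_perPoly_four_le_twentyNine K two_ne_zero⟩
  letI : Invertible (2 : K) := invertibleOfNonzero two_ne_zero
  obtain ⟨A, hS, hA⟩ :=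
    hasSymmDetRepr_symmDeterminantalComplexity
      ⟨_, SymPencilSdcPerThreeWindow.hasSymmDetRepr_perPoly_quarez K 4⟩
  exact twentySeven_le_of_isSymm_isAffineDetRepr_perPoly_four K hS hA

/-- The complex instance: `27 ≤ sdc(per₄) ≤ 29` over `ℂ`. [folklore] -/
theorem sdc_perPoly_four_window_twentySeven_complex :
    27 ≤ symmDeterminantalComplexity (perPoly (Fin 4) ℂ) ∧
      symmDeterminantalComplexity (perPoly (Fin 4) ℂ) ≤ 29 :=
  sdc_perPoly_four_window_twentySeven ℂ

end Summit.ValiantsHypothesis.ValiantsHypothesis.Theorems.SymPencilSdcPerFourWindowTwentySeven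

end
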